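import Mathlib
import Summits.NavierStokesRegularity.NavierStokesRegularity.Theorems.ThreadingFluxCentreJetEulerTopIntegrals
import Summits.NavierStokesRegularity.NavierStokesRegularity.Theorems.ThreadingFluxCentreJetHarmonicPolhode
import HarnessLib

/-!
# Crux `PoloidalLiouville` (stmt-NavierStokesRegularity-1222, wall W1), crux idea «steady-centre-sieve» (ns-idea-15 g5):
# the bracket `{·, ⟪y,Sy⟫} = 2 W·∇` is injective on harmonic `n`-forms, `n ≥ 3`

The corollary of A1 (`CentreJet.eulerTopFirstIntegrals`) and A2 (`CentreJet.noHarmonicPolhodeInvariant`) that the card's lemma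
L1 `TriaxialToroidalJetRigidity` uses degree by degree (CentreJetSketch, docstrings of A2 and L1: «the bracket
`X = {·, ⟪y,Sy⟫} = 2 W·∇` is INJECTIVE on harmonic `n`-forms for `n ≥ 3` when `S` is triaxial (A1 + A2; engine: rank `2n+1`
for `3 ≤ n ≤ 11`)» — now for every `n`): for pairwise distinct traceless strains `a`, a homogeneous HARMONIC polynomial of
degree `n ≥ 3` annihilated by `W·∇` vanishes.  Proof: by A1 it is `F(|y|², ⟪y,Sy⟫)`, by A2 `F = c₀ + c₁ v₁`, so the
polynomial is `c₀ + c₁⟪y,Sy⟫`, whose degree-`n` homogeneous component is `0` for `n ≥ 3`.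

Information-grade algebra about one crux idea's typed objects (`--supports 1222` helper); L1 itself stays a paper lemma
(needs the jet bookkeeping of the steady system); `PoloidalLiouville` (1222) OPEN; NS regularity NOT proved.
ns-wall-eng-5 g5 (cell ns-wall-extremal), 0 kit.
-/

-- the summit and its single sub-problem share the name (CONVENTIONS §1)
set_option linter.dupNamespace false

noncomputable section

namespace Summit.NavierStokesRegularity.NavierStokesRegularity.Theorems.PoloidalLiouville.CentreJet

open MvPolynomial

/-- `⟪y, S y⟫` is homogeneous of degree `2`. -/
theorem isHomogeneous_strainPoly (a : Fin 3 → ℝ) : (strainPoly a).IsHomogeneous 2 := by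
  unfold strainPoly
  refine IsHomogeneous.sum _ _ _ fun i _ => ?_
  simpa using (isHomogeneous_X ℝ i).pow 2 |>.C_mul (a i)

/-- **Injectivity of the polhode bracket on harmonic forms of degree `≥ 3`** (A1 + A2): for pairwise distinct `aᵢ` with
`Σ aᵢ = 0`, a homogeneous harmonic polynomial `T` of degree `n ≥ 3` with `W·∇T = Σᵢ Wᵢ ∂ᵢ T = 0` is zero. -/
theorem eq_zero_of_harmonic_eulerTop_integral (a : Fin 3 → ℝ) (ha : Function.Injective a) (hsum : ∑ i, a i = 0)
    {n : ℕ} (hn : 3 ≤ n) (T : MvPolynomial (Fin 3) ℝ) (hT : T.IsHomogeneous n)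
    (hL : ∑ i : Fin 3, eulerTopField a i * pderiv i T = 0)
    (hΔ : ∑ i : Fin 3, pderiv i (pderiv i T) = 0) : T = 0 := by
  classical
  obtain ⟨F, hF⟩ := eulerTopFirstIntegrals a ha T hL
  have hΔF : ∑ i : Fin 3, pderiv i (pderiv i (aeval ![rhoPoly, strainPoly a] F)) = 0 := by rw [← hF]; exact hΔ
  obtain ⟨c₀, c₁, hc⟩ := noHarmonicPolhodeInvariant a ha hsum F hΔF
  -- so `T = C c₀ + C c₁ * ⟪y,Sy⟫`, of degree ≤ 2
  have hT' : T = C c₀ + C c₁ * strainPoly a := by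
    rw [hF, hc]
    simp
  -- compare degree-`n` homogeneous components
  have h0 : homogeneousComponent n (C c₀ : MvPolynomial (Fin 3) ℝ) = 0 := by
    rw [homogeneousComponent_of_mem (isHomogeneous_C (Fin 3) c₀), if_neg (by omega)]
  have h2 : homogeneousComponent n (C c₁ * strainPoly a) = 0 := by
    rw [homogeneousComponent_of_mem ((isHomogeneous_strainPoly a).C_mul c₁), if_neg (by omega)]
  calc T = homogeneousComponent n T := (homogeneousComponent_eq_self hT).symm
    _ = 0 := by rw [hT', map_add, h0, h2, add_zero]

end Summit.NavierStokesRegularity.NavierStokesRegularity.Theorems.PoloidalLiouville.CentreJet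

end
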